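import Mathlib

/-!
# Hidden corner lemma (`R`-side): a generic good point for the `F`-side defect bound

Stub `GoodPoint` for the crux line of `HiddenCornerLemmaR` (Theorem 2).

Given a pencil `X ↦ T(X) := ∑ a b, X a b • T a b` of `N × N` complex matrices parametrised by
`r × r` matrices `X`, a nilpotent `B` and any `A`, assume `T(X₀)` is nonsingular for some `X₀` and
that nonsingularity of `T(X)` forces `X` to be invertible. We produce an `X` with both `T(X)` and
`X⁻¹ - B X⁻¹ A` invertible (`hclR_exists_good_point`).

## Proof sketch

Write `Φ(Y) := Y - B Y A`. Since `B ^ k = 0`, the matrix `M₀ := ∑_{i<k} Bⁱ Aⁱ` telescopes to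
`Φ(M₀) = 1`. Put `Y₀ := X₀⁻¹` (invertible, with `Y₀⁻¹ = X₀`) and consider the line
`Y(t) := Y₀ + t • M₀`, `t ∈ ℂ`; the sought point is `X := Y(t)⁻¹` for a generic `t`. Three
conditions each fail for only finitely many `t`, because each is the non-vanishing of a polynomial
in `t` which is not the zero polynomial:
* `det Y(t) ≠ 0` (value `det Y₀ ≠ 0` at `t = 0`);
* `det Φ(Y(t)) = det (Φ Y₀ + t • 1) ≠ 0`: for `t ≠ 0` this is `t ^ r * det (1 + t⁻¹ • Φ Y₀)`, and
  `δ ↦ det (1 + δ • Φ Y₀)` has value `1` at `δ = 0`;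
* `det T(adj Y(t)) ≠ 0` (value at `t = 0`: `adj Y₀ = det Y₀ • X₀`, so the determinant is
  `(det Y₀) ^ N * det T(X₀) ≠ 0`); the entries of the adjugate of `Y₀.map C + X • M₀.map C` are
  polynomials, evaluated via `RingHom.map_adjugate`.
As `ℂ` is infinite, some `t` avoids the three finite bad sets. Then `X := Y(t)⁻¹` satisfies
`X⁻¹ = Y(t)`, so `det Φ(X⁻¹) ≠ 0`, and `X = (det Y(t))⁻¹ • adj Y(t)` gives
`det T(X) = ((det Y(t))⁻¹) ^ N * det T(adj Y(t)) ≠ 0`.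
-/

set_option linter.dupNamespace false

namespace Summit.MatrixMultiplication.MatrixMultiplication.Theorems

open Matrix

/-- Evaluating the polynomial matrix `P.map C + X • Q.map C` at `t` gives `P + t • Q`. -/
private lemma hclR_gp_mapMatrix_pencil {n : Type*} [Fintype n] [DecidableEq n]
    (P Q : Matrix n n ℂ) (t : ℂ) :
    (Polynomial.evalRingHom t).mapMatrix
        (P.map Polynomial.C + (Polynomial.X : Polynomial ℂ) • Q.map Polynomial.C) = P + t • Q := by
  ext i j
  simp only [RingHom.mapMatrix_apply, Matrix.map_apply, Matrix.add_apply, Matrix.smul_apply,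
    smul_eq_mul, Polynomial.coe_evalRingHom, Polynomial.eval_add, Polynomial.eval_mul,
    Polynomial.eval_C, Polynomial.eval_X]

/-- `det (P + t • Q)` is the value at `t` of the polynomial `det (P.map C + X • Q.map C)`. -/
private lemma hclR_gp_eval_det_pencil {n : Type*} [Fintype n] [DecidableEq n]
    (P Q : Matrix n n ℂ) (t : ℂ) :
    (P.map Polynomial.C + (Polynomial.X : Polynomial ℂ) • Q.map Polynomial.C).det.eval t =
      (P + t • Q).det := by
  rw [← Polynomial.coe_evalRingHom, RingHom.map_det, hclR_gp_mapMatrix_pencil]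

/-- The entries of the adjugate along the pencil `P + t • Q` are polynomials in `t`. -/
private lemma hclR_gp_eval_adjugate_pencil {n : Type*} [Fintype n] [DecidableEq n]
    (P Q : Matrix n n ℂ) (t : ℂ) (a b : n) :
    ((P.map Polynomial.C + (Polynomial.X : Polynomial ℂ) • Q.map Polynomial.C).adjugate a b).eval t
      = (P + t • Q).adjugate a b := by
  have h := RingHom.map_adjugate (Polynomial.evalRingHom t)
    (P.map Polynomial.C + (Polynomial.X : Polynomial ℂ) • Q.map Polynomial.C)
  rw [hclR_gp_mapMatrix_pencil] at h
  rw [← h, RingHom.mapMatrix_apply, Matrix.map_apply, Polynomial.coe_evalRingHom]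

/-- `det T(adj (P + t • Q))` is the value at `t` of a polynomial, for the pencil
`T(Z) := ∑ a b, Z a b • T a b`. -/
private lemma hclR_gp_eval_det_pencilT {r N : ℕ} (T : Fin r → Fin r → Matrix (Fin N) (Fin N) ℂ)
    (P Q : Matrix (Fin r) (Fin r) ℂ) (t : ℂ) :
    (∑ a : Fin r, ∑ b : Fin r,
        (P.map Polynomial.C + (Polynomial.X : Polynomial ℂ) • Q.map Polynomial.C).adjugate a b •
          (T a b).map Polynomial.C).det.eval t =
      (∑ a : Fin r, ∑ b : Fin r, (P + t • Q).adjugate a b • T a b).det := by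
  rw [← Polynomial.coe_evalRingHom, RingHom.map_det]
  congr 1
  ext i j
  simp [Matrix.map_apply, Matrix.sum_apply, hclR_gp_eval_adjugate_pencil]

/-- A complex function given by a polynomial and non-vanishing at one point has finitely many
zeros. -/
private lemma hclR_gp_finite_zeros (p : Polynomial ℂ) (f : ℂ → ℂ) (hf : ∀ t, p.eval t = f t)
    (t₀ : ℂ) (h0 : f t₀ ≠ 0) : Set.Finite {t : ℂ | f t = 0} := by
  have hp : p ≠ 0 := by
    rintro rfl
    exact h0 (by rw [← hf, Polynomial.eval_zero])
  refine (Polynomial.finite_setOf_isRoot hp).subset ?_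
  intro t ht
  simp only [Set.mem_setOf_eq] at ht ⊢
  rw [Polynomial.IsRoot.def, hf]
  exact ht

/-- Along a pencil `P + t • Q` with `P` nonsingular, only finitely many `t` are singular. -/
private lemma hclR_gp_finite_singular_left {n : Type*} [Fintype n] [DecidableEq n]
    (P Q : Matrix n n ℂ) (hP : P.det ≠ 0) : Set.Finite {t : ℂ | (P + t • Q).det = 0} :=
  hclR_gp_finite_zeros _ (fun t => (P + t • Q).det) (hclR_gp_eval_det_pencil P Q) 0
    (by simpa using hP)

/-- Along a pencil `P + t • Q` with `Q` nonsingular, only finitely many `t` are singular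
(homogeneity: `P + t • Q = t • (Q + t⁻¹ • P)` for `t ≠ 0`). -/
private lemma hclR_gp_finite_singular_right {n : Type*} [Fintype n] [DecidableEq n]
    (P Q : Matrix n n ℂ) (hQ : Q.det ≠ 0) : Set.Finite {t : ℂ | (P + t • Q).det = 0} := by
  have hfin : Set.Finite (Inv.inv ⁻¹' {δ : ℂ | (Q + δ • P).det = 0}) :=
    (hclR_gp_finite_singular_left Q P hQ).preimage inv_injective.injOn
  refine (hfin.union (Set.finite_singleton 0)).subset ?_
  intro t ht
  simp only [Set.mem_setOf_eq] at ht
  by_cases ht0 : t = 0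
  · exact Or.inr ht0
  · left
    simp only [Set.mem_preimage, Set.mem_setOf_eq]
    have key : P + t • Q = t • (Q + t⁻¹ • P) := by
      rw [smul_add, smul_smul, mul_inv_cancel₀ ht0, one_smul, add_comm]
    rw [key, Matrix.det_smul] at ht
    exact (mul_eq_zero.mp ht).resolve_left (pow_ne_zero _ ht0)

/-- The pencil `Z ↦ ∑ Z a b • T a b` is homogeneous. -/
private lemma hclR_gp_pencil_smul {r N : ℕ} (T : Fin r → Fin r → Matrix (Fin N) (Fin N) ℂ)
    (c : ℂ) (Z : Matrix (Fin r) (Fin r) ℂ) :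
    (∑ a : Fin r, ∑ b : Fin r, (c • Z) a b • T a b) =
      c • ∑ a : Fin r, ∑ b : Fin r, Z a b • T a b := by
  simp only [Matrix.smul_apply, smul_eq_mul, mul_smul, Finset.smul_sum]

/-- Good point for the F-side defect bound: if the pencil `X ↦ Σ X a b • T a b` is nonsingular at
some `X₀`, nonsingular values force `X` invertible (`hinj`), and `B` is nilpotent, then some `X`
makes both `T(X)` and `X⁻¹ − B X⁻¹ A` invertible. -/
theorem hclR_exists_good_point (r N : ℕ) (T : Fin r → Fin r → Matrix (Fin N) (Fin N) ℂ)
    (A B : Matrix (Fin r) (Fin r) ℂ) (hB : IsNilpotent B)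
    (hns : ∃ X₀ : Matrix (Fin r) (Fin r) ℂ, (∑ a : Fin r, ∑ b : Fin r, X₀ a b • T a b).det ≠ 0)
    (hinj : ∀ X : Matrix (Fin r) (Fin r) ℂ,
      (∑ a : Fin r, ∑ b : Fin r, X a b • T a b).det ≠ 0 → IsUnit X.det) :
    ∃ X : Matrix (Fin r) (Fin r) ℂ, IsUnit (∑ a : Fin r, ∑ b : Fin r, X a b • T a b).det ∧
      IsUnit (X⁻¹ - B * X⁻¹ * A).det := by
  obtain ⟨X₀, hX₀⟩ := hns
  have hX₀u : IsUnit X₀.det := hinj X₀ hX₀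
  obtain ⟨k, hk⟩ := hB
  -- Step 0: a preimage `M₀` of `1` under `Φ(Y) = Y - B Y A` (telescoping sum).
  obtain ⟨M₀, hM₀⟩ : ∃ M₀ : Matrix (Fin r) (Fin r) ℂ, M₀ - B * M₀ * A = 1 := by
    refine ⟨∑ i ∈ Finset.range k, B ^ i * A ^ i, ?_⟩
    have h1 : B * (∑ i ∈ Finset.range k, B ^ i * A ^ i) * A =
        ∑ i ∈ Finset.range k, B ^ (i + 1) * A ^ (i + 1) := by
      rw [Finset.mul_sum, Finset.sum_mul]
      refine Finset.sum_congr rfl fun i _ => ?_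
      rw [pow_succ' B, pow_succ A]
      simp only [Matrix.mul_assoc]
    have h2 : ∑ i ∈ Finset.range k, (B ^ i * A ^ i - B ^ (i + 1) * A ^ (i + 1)) =
        B ^ 0 * A ^ 0 - B ^ k * A ^ k :=
      Finset.sum_range_sub' (fun i => B ^ i * A ^ i) k
    rw [h1, ← Finset.sum_sub_distrib, h2, hk, pow_zero, pow_zero, Matrix.one_mul,
      Matrix.zero_mul, sub_zero]
  -- The base point `Y₀ = X₀⁻¹` of the line `Y₀ + t • M₀`.
  set Y₀ : Matrix (Fin r) (Fin r) ℂ := X₀⁻¹ with hY₀def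
  have hY₀u : IsUnit Y₀.det := (Matrix.isUnit_nonsing_inv_det_iff).2 hX₀u
  have hY₀ne : Y₀.det ≠ 0 := hY₀u.ne_zero
  have hY₀inv : Y₀⁻¹ = X₀ := Matrix.nonsing_inv_nonsing_inv X₀ hX₀u
  have hadjY₀ : Y₀.adjugate = Y₀.det • X₀ := by
    rw [← hY₀inv, Matrix.inv_def, smul_smul, Ring.mul_inverse_cancel _ hY₀u, one_smul]
  -- `Φ` along the line.
  have hΦ : ∀ t : ℂ, (Y₀ + t • M₀) - B * (Y₀ + t • M₀) * A = (Y₀ - B * Y₀ * A) + t • 1 := by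
    intro t
    rw [← hM₀]
    simp only [Matrix.mul_add, Matrix.add_mul, Matrix.mul_smul, Matrix.smul_mul, smul_sub]
    abel
  -- The three finite bad sets.
  have hfa : Set.Finite {t : ℂ | (Y₀ + t • M₀).det = 0} :=
    hclR_gp_finite_singular_left Y₀ M₀ hY₀ne
  have hfb : Set.Finite
      {t : ℂ | ((Y₀ - B * Y₀ * A) + t • (1 : Matrix (Fin r) (Fin r) ℂ)).det = 0} :=
    hclR_gp_finite_singular_right _ _ (by simp)
  have hfc : Set.Finite
      {t : ℂ | (∑ a : Fin r, ∑ b : Fin r, (Y₀ + t • M₀).adjugate a b • T a b).det = 0} := by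
    refine hclR_gp_finite_zeros _
      (fun t => (∑ a : Fin r, ∑ b : Fin r, (Y₀ + t • M₀).adjugate a b • T a b).det)
      (hclR_gp_eval_det_pencilT T Y₀ M₀) 0 ?_
    simp only [zero_smul, add_zero]
    rw [hadjY₀, hclR_gp_pencil_smul, Matrix.det_smul]
    exact mul_ne_zero (pow_ne_zero _ hY₀ne) hX₀
  -- A good parameter `t`, avoiding the three bad sets (`ℂ` is infinite).
  obtain ⟨t, ht⟩ := ((hfa.union hfb).union hfc).infinite_compl.nonempty
  simp only [Set.mem_compl_iff, Set.mem_union, Set.mem_setOf_eq, not_or] at ht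
  obtain ⟨⟨hta, htb⟩, htc⟩ := ht
  have hYu : IsUnit (Y₀ + t • M₀).det := isUnit_iff_ne_zero.2 hta
  refine ⟨(Y₀ + t • M₀)⁻¹, ?_, ?_⟩
  · rw [Matrix.nonsing_inv_apply _ hYu, hclR_gp_pencil_smul, Matrix.det_smul, isUnit_iff_ne_zero]
    exact mul_ne_zero (pow_ne_zero _ (Units.ne_zero _)) htc
  · rw [Matrix.nonsing_inv_nonsing_inv _ hYu, hΦ t, isUnit_iff_ne_zero]
    exact htb

end Summit.MatrixMultiplication.MatrixMultiplication.Theorems
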